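import Summits.Langlands.Langlands.Theorems.QuadraticWindowHostInducedRepAsaiLocalIdentityQ
import Literature.NumberTheory.Automorphic.AutomorphicInductionCuspidalProofs
import Literature.NumberTheory.Automorphic.AdelicGroupDataAutomorphicMeasureProofs

/-!
# The factorisation `L^S(z, Q, As^η_{K/F₀}) = L^{S'}(z, P, As^η_{L/F'}) · L^{S''}(z, P, As^η_{L/F})` of raw
partial Asai Euler products — helper file 6 for stub `stub_asaiPoleInduced` of line
`one-transparent-pane`
(crux `Summit.Langlands.Langlands.Theses.QuadraticWindow.HostInducedRep`, item stmt-Langlands-10902)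

LOG (worker `stub_asaiPoleInduced`).  FACT-FREE.

* `tprod_regroup`, `multipliable_regroup` — regrouping an unconditional product over the places of an
  extension `E'/F₀` outside the preimage of `S` along `v' ↦ v' ∩ 𝓞 F₀`
  (`placesNotOverEquivSigma`, `Multipliable.tprod_sigma'`, `HasProd.sigma`);
* `partialAsaiL_induced_eq_mul` — **the factorisation** of the raw partial Asai product of a family `A`
  over `K` induced above the complement of `S` from a family `A'` over `L`, GRANTED multipliability of
  the two `L`-side products at `z` (local identity `local_factor_eq` place by place);
* `exists_matched_data` — for cuspidal `P` on `GL_n/L` and `Q` on `GL_{2n}/K` with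
  `IsAutomorphicInductionAlong P Q`: a finite `S₁` and Satake families `A`, `A'` forming Asai data of
  `Q` w.r.t. `(K/F₀, cK)` and of `P` w.r.t. `(L/F', sF)` and `(L/F, θF)` (off the preimages of `S₁`),
  induced from one another above the complement of `S₁`, every place outside `S₁` being unramified
  in `K`, `L` and below unramified places of `K`, `F'`, `F` (Flath `hasSatakeParamAt_cofinite_holds`,
  `hasSatakeParamAt_unique_holds`, `finite_setOf_not_isUnramifiedIn`);
* `IsConjSelfDualAE.eventually_norm_prod_eq_one` — **a conjugate self-dual cuspidal datum is unitary
  almost everywhere**: `|det t_{P,w}| = 1` for almost all `w` (unitary normalisation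
  `CuspidalAutomorphicRepData.exists_satake_eq_cpow_mul_L2_unconditional`, Borel–Jacquet 5.7, and
  `|det t| = 1` in `L²`, `HasSatakeParameterAt.norm_prod_eq_one`: `t_{P,w} = q_w^{s} u_w` with
  `|det u_w| = 1`, and `t_{P,cw} = t_{P,w}⁻¹` forces `re s = 0`).
LANDING LOG (wave 3): registered anchor `asaiGlobalFactorisation_anchor` at the end. [folklore]
-/

set_option linter.dupNamespace false -- project-wide option (lakefile weak.linter.dupNamespace); `Summit.Langlands.Langlands` is the mandated namespace

open scoped Classical Topology
open Literature.NumberTheory.Automorphic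
open Summit.Langlands.Langlands.Theorems.HostInducedRep.Negative
open IsDedekindDomain NumberField Polynomial Filter

namespace Summit.Langlands.Langlands.Theorems.HostInducedRep.OneTransparentPane

/-! ### Regrouping products over the places of an extension -/

section Regroup

variable {F₀ E' : Type} [Field F₀] [NumberField F₀] [Field E'] [NumberField E'] [Algebra F₀ E']

/-- **Regrouping along `v' ↦ v' ∩ 𝓞 F₀`**: a multipliable product over the places `v'` of `E'` with
`v' ∩ 𝓞 F₀ ∉ S` is the product over `v ∉ S` of the finite products over the places above `v`, and the
latter family is multipliable with the same value. [folklore] -/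
theorem hasProd_regroup (S : Set (HeightOneSpectrum (𝓞 F₀))) {g : HeightOneSpectrum (𝓞 E') → ℂ}
    (hg : Multipliable fun v' : {v' : HeightOneSpectrum (𝓞 E') // v'.under (𝓞 F₀) ∉ S} => g v'.1) :
    HasProd (fun v : {v : HeightOneSpectrum (𝓞 F₀) // v ∉ S} =>
        ∏' v' : {v' : HeightOneSpectrum (𝓞 E') // v'.under (𝓞 F₀) = v.1}, g v'.1)
      (∏' v' : {v' : HeightOneSpectrum (𝓞 E') // v'.under (𝓞 F₀) ∉ S}, g v'.1) := by
  set e := placesNotOverEquivSigma (E := E') S with he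
  set f : {v' : HeightOneSpectrum (𝓞 E') // v'.under (𝓞 F₀) ∉ S} → ℂ := fun v' => g v'.1 with hf
  have hmul : Multipliable (f ∘ e) := (Equiv.multipliable_iff e).mpr hg
  have hfib : ∀ v : {v : HeightOneSpectrum (𝓞 F₀) // v ∉ S},
      HasProd (fun v' : {v' : HeightOneSpectrum (𝓞 E') // v'.under (𝓞 F₀) = v.1} => (f ∘ e) ⟨v, v'⟩)
        (∏' v' : {v' : HeightOneSpectrum (𝓞 E') // v'.under (𝓞 F₀) = v.1}, g v'.1) := fun v => by
    haveI := finite_placesOver (E := E') v.1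
    exact (Multipliable.of_finite).hasProd
  have h := hmul.hasProd.sigma hfib
  rwa [show (∏' b, (f ∘ ⇑e) b) = ∏' b, f b from Equiv.tprod_eq e f] at h

/-- The regrouped family is multipliable … [folklore] -/
theorem multipliable_regroup (S : Set (HeightOneSpectrum (𝓞 F₀))) {g : HeightOneSpectrum (𝓞 E') → ℂ}
    (hg : Multipliable fun v' : {v' : HeightOneSpectrum (𝓞 E') // v'.under (𝓞 F₀) ∉ S} => g v'.1) :
    Multipliable fun v : {v : HeightOneSpectrum (𝓞 F₀) // v ∉ S} =>
      ∏' v' : {v' : HeightOneSpectrum (𝓞 E') // v'.under (𝓞 F₀) = v.1}, g v'.1 :=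
  (hasProd_regroup S hg).multipliable

/-- … with the same value. [folklore] -/
theorem tprod_regroup (S : Set (HeightOneSpectrum (𝓞 F₀))) {g : HeightOneSpectrum (𝓞 E') → ℂ}
    (hg : Multipliable fun v' : {v' : HeightOneSpectrum (𝓞 E') // v'.under (𝓞 F₀) ∉ S} => g v'.1) :
    ∏' v' : {v' : HeightOneSpectrum (𝓞 E') // v'.under (𝓞 F₀) ∉ S}, g v'.1 =
      ∏' v : {v : HeightOneSpectrum (𝓞 F₀) // v ∉ S},
        ∏' v' : {v' : HeightOneSpectrum (𝓞 E') // v'.under (𝓞 F₀) = v.1}, g v'.1 :=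
  (hasProd_regroup S hg).tprod_eq.symm

omit [NumberField F₀] in
/-- The partial Asai product off the preimage of `S` is a product over `{v' // v' ∩ 𝓞 F₀ ∉ S}`
(definitional). [folklore] -/
theorem partialAsaiL_preimage {L : Type} [Field L] [Algebra E' L] (S : Set (HeightOneSpectrum (𝓞 F₀)))
    (θ : L ≃ₐ[E'] L) (A' : SatakeFamily L) (η : ℤˣ) (z : ℂ) :
    partialAsaiL ((fun v' : HeightOneSpectrum (𝓞 E') => v'.under (𝓞 F₀)) ⁻¹' S) θ A' η z =
      ∏' v' : {v' : HeightOneSpectrum (𝓞 E') // v'.under (𝓞 F₀) ∉ S},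
        ((asaiLocalPolynomial θ A' η (placeAbove L v'.1)).eval (((v'.1.residueCard : ℕ) : ℂ) ^ (-z)))⁻¹ :=
  rfl

end Regroup

/-! ### The factorisation of the raw partial Asai products -/

section Factorisation

variable {F₀ K F' F L : Type} [Field F₀] [NumberField F₀] [Field K] [NumberField K]
  [Field F'] [NumberField F'] [Field F] [NumberField F] [Field L] [NumberField L]
  [Algebra F₀ K] [Algebra K L] [Algebra F₀ L] [IsScalarTower F₀ K L]
  [Algebra F₀ F'] [Algebra F' L] [IsScalarTower F₀ F' L]
  [Algebra F₀ F] [Algebra F L] [IsScalarTower F₀ F L]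

/-- **`L^S(z, A, As^η_{K/F₀}) = L^{S'}(z, A', As^η_{L/F'}) · L^{S''}(z, A', As^η_{L/F})` for the raw
partial Euler products**, `S'`, `S''` the preimages of `S` in `F'`, `F`, whenever the two right-hand
products are multipliable at `z`: `A'` a Satake family over `L`, `A` a family over `K` induced from
`A'` above every `v ∉ S`, every `v ∉ S` unramified in `L` with the places of `K`, `F'`, `F` above it
unramified in `L` (local identity `local_factor_eq` and regrouping). [folklore] -/
theorem partialAsaiL_induced_eq_mul (h4 : Module.finrank F₀ L = 4) (h2 : Module.finrank F₀ K = 2)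
    (h2K : Module.finrank K L = 2) (h2F' : Module.finrank F' L = 2) (h2F : Module.finrank F L = 2)
    {cK : K ≃ₐ[F₀] K} (hcK : cK ≠ 1) {t : L ≃ₐ[K] L} (ht : t ≠ 1) {sF : L ≃ₐ[F'] L} (hsF : sF ≠ 1)
    {θF : L ≃ₐ[F] L} (hθF : θF ≠ 1)
    (hsK : ∀ x : K, sF.restrictScalars F₀ (algebraMap K L x) = algebraMap K L (cK x))
    (hθF₀ : θF.restrictScalars F₀ = sF.restrictScalars F₀ * t.restrictScalars F₀)
    {S : Set (HeightOneSpectrum (𝓞 F₀))}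
    (hSL : ∀ v ∉ S, Algebra.IsUnramifiedIn (𝓞 L) v.asIdeal)
    (hSK : ∀ u : HeightOneSpectrum (𝓞 K), u.under (𝓞 F₀) ∉ S → Algebra.IsUnramifiedIn (𝓞 L) u.asIdeal)
    (hSF' : ∀ v' : HeightOneSpectrum (𝓞 F'), v'.under (𝓞 F₀) ∉ S → Algebra.IsUnramifiedIn (𝓞 L) v'.asIdeal)
    (hSF : ∀ v'' : HeightOneSpectrum (𝓞 F), v''.under (𝓞 F₀) ∉ S → Algebra.IsUnramifiedIn (𝓞 L) v''.asIdeal)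
    {A : SatakeFamily K} {A' : SatakeFamily L}
    (hA : ∀ u : HeightOneSpectrum (𝓞 K), u.under (𝓞 F₀) ∉ S →
      satakePolynomial (A u) = inducedSatakePolynomial u A')
    (η : ℤˣ) {z : ℂ}
    (hmF' : Multipliable fun v' : {v' : HeightOneSpectrum (𝓞 F') // v'.under (𝓞 F₀) ∉ S} =>
      ((asaiLocalPolynomial sF A' η (placeAbove L v'.1)).eval (((v'.1.residueCard : ℕ) : ℂ) ^ (-z)))⁻¹)
    (hmF : Multipliable fun v'' : {v'' : HeightOneSpectrum (𝓞 F) // v''.under (𝓞 F₀) ∉ S} =>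
      ((asaiLocalPolynomial θF A' η (placeAbove L v''.1)).eval (((v''.1.residueCard : ℕ) : ℂ) ^ (-z)))⁻¹) :
    partialAsaiL S cK A η z =
      partialAsaiL ((fun v' : HeightOneSpectrum (𝓞 F') => v'.under (𝓞 F₀)) ⁻¹' S) sF A' η z *
        partialAsaiL ((fun v'' : HeightOneSpectrum (𝓞 F) => v''.under (𝓞 F₀)) ⁻¹' S) θF A' η z := by
  have e₁ := tprod_regroup S
    (g := fun v' => ((asaiLocalPolynomial sF A' η (placeAbove L v')).eval (((v'.residueCard : ℕ) : ℂ) ^ (-z)))⁻¹)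
    hmF'
  have e₂ := tprod_regroup S
    (g := fun v'' => ((asaiLocalPolynomial θF A' η (placeAbove L v'')).eval (((v''.residueCard : ℕ) : ℂ) ^ (-z)))⁻¹)
    hmF
  have m₁ := multipliable_regroup S
    (g := fun v' => ((asaiLocalPolynomial sF A' η (placeAbove L v')).eval (((v'.residueCard : ℕ) : ℂ) ^ (-z)))⁻¹)
    hmF'
  have m₂ := multipliable_regroup S
    (g := fun v'' => ((asaiLocalPolynomial θF A' η (placeAbove L v'')).eval (((v''.residueCard : ℕ) : ℂ) ^ (-z)))⁻¹)
    hmF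
  beta_reduce at e₁ e₂ m₁ m₂
  rw [partialAsaiL_preimage, partialAsaiL_preimage, e₁, e₂, ← Multipliable.tprod_mul m₁ m₂]
  unfold partialAsaiL
  refine tprod_congr fun v => ?_
  exact local_factor_eq h4 h2 h2K h2F' h2F hcK ht hsF hθF hsK hθF₀ (placeAbove_under (E := L) v.1)
    (hSL v.1 v.2) (fun u hu => hSK u (by rw [hu]; exact v.2)) (fun v' hv' => hSF' v' (by rw [hv']; exact v.2))
    (fun v'' hv'' => hSF v'' (by rw [hv'']; exact v.2)) A A' (fun u hu => hA u (by rw [hu]; exact v.2)) η z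

/-- The `K`-side raw product is then multipliable as well. [folklore] -/
theorem multipliable_partialAsaiL_induced (h4 : Module.finrank F₀ L = 4) (h2 : Module.finrank F₀ K = 2)
    (h2K : Module.finrank K L = 2) (h2F' : Module.finrank F' L = 2) (h2F : Module.finrank F L = 2)
    {cK : K ≃ₐ[F₀] K} (hcK : cK ≠ 1) {t : L ≃ₐ[K] L} (ht : t ≠ 1) {sF : L ≃ₐ[F'] L} (hsF : sF ≠ 1)
    {θF : L ≃ₐ[F] L} (hθF : θF ≠ 1)
    (hsK : ∀ x : K, sF.restrictScalars F₀ (algebraMap K L x) = algebraMap K L (cK x))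
    (hθF₀ : θF.restrictScalars F₀ = sF.restrictScalars F₀ * t.restrictScalars F₀)
    {S : Set (HeightOneSpectrum (𝓞 F₀))}
    (hSL : ∀ v ∉ S, Algebra.IsUnramifiedIn (𝓞 L) v.asIdeal)
    (hSK : ∀ u : HeightOneSpectrum (𝓞 K), u.under (𝓞 F₀) ∉ S → Algebra.IsUnramifiedIn (𝓞 L) u.asIdeal)
    (hSF' : ∀ v' : HeightOneSpectrum (𝓞 F'), v'.under (𝓞 F₀) ∉ S → Algebra.IsUnramifiedIn (𝓞 L) v'.asIdeal)
    (hSF : ∀ v'' : HeightOneSpectrum (𝓞 F), v''.under (𝓞 F₀) ∉ S → Algebra.IsUnramifiedIn (𝓞 L) v''.asIdeal)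
    {A : SatakeFamily K} {A' : SatakeFamily L}
    (hA : ∀ u : HeightOneSpectrum (𝓞 K), u.under (𝓞 F₀) ∉ S →
      satakePolynomial (A u) = inducedSatakePolynomial u A')
    (η : ℤˣ) {z : ℂ}
    (hmF' : Multipliable fun v' : {v' : HeightOneSpectrum (𝓞 F') // v'.under (𝓞 F₀) ∉ S} =>
      ((asaiLocalPolynomial sF A' η (placeAbove L v'.1)).eval (((v'.1.residueCard : ℕ) : ℂ) ^ (-z)))⁻¹)
    (hmF : Multipliable fun v'' : {v'' : HeightOneSpectrum (𝓞 F) // v''.under (𝓞 F₀) ∉ S} =>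
      ((asaiLocalPolynomial θF A' η (placeAbove L v''.1)).eval (((v''.1.residueCard : ℕ) : ℂ) ^ (-z)))⁻¹) :
    Multipliable fun v : {v : HeightOneSpectrum (𝓞 F₀) // v ∉ S} =>
      ((asaiLocalPolynomial cK A η (placeAbove K v.1)).eval (((v.1.residueCard : ℕ) : ℂ) ^ (-z)))⁻¹ := by
  have m₁ := multipliable_regroup S
    (g := fun v' => ((asaiLocalPolynomial sF A' η (placeAbove L v')).eval (((v'.residueCard : ℕ) : ℂ) ^ (-z)))⁻¹)
    hmF'
  have m₂ := multipliable_regroup S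
    (g := fun v'' => ((asaiLocalPolynomial θF A' η (placeAbove L v'')).eval (((v''.residueCard : ℕ) : ℂ) ^ (-z)))⁻¹)
    hmF
  beta_reduce at m₁ m₂
  refine (m₁.mul m₂).congr fun v => ?_
  exact (local_factor_eq h4 h2 h2K h2F' h2F hcK ht hsF hθF hsK hθF₀ (placeAbove_under (E := L) v.1)
    (hSL v.1 v.2) (fun u hu => hSK u (by rw [hu]; exact v.2)) (fun v' hv' => hSF' v' (by rw [hv']; exact v.2))
    (fun v'' hv'' => hSF v'' (by rw [hv'']; exact v.2)) A A' (fun u hu => hA u (by rw [hu]; exact v.2)) η z).symm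

end Factorisation

/-! ### Unitarity almost everywhere of a conjugate self-dual cuspidal datum -/

section Unitary

variable {F E : Type} [Field F] [NumberField F] [Field E] [NumberField E] [Algebra F E]

/-- `b^x = (a^x)⁻¹` with `a, b > 1` forces `x = 0`. [folklore] -/
theorem eq_zero_of_rpow_eq_inv_rpow {a b x : ℝ} (ha : 1 < a) (hb : 1 < b) (h : b ^ x = (a ^ x)⁻¹) :
    x = 0 := by
  by_contra hx
  rcases lt_or_gt_of_ne hx with hx | hx
  · have h1 : b ^ x < 1 := Real.rpow_lt_one_of_one_lt_of_neg hb hx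
    have h2 : a ^ x < 1 := Real.rpow_lt_one_of_one_lt_of_neg ha hx
    have h3 : 0 < a ^ x := Real.rpow_pos_of_pos (by linarith) x
    have : 1 < (a ^ x)⁻¹ := one_lt_inv₀ h3 |>.mpr h2
    linarith
  · have h1 : 1 < b ^ x := Real.one_lt_rpow hb hx
    have h2 : 1 < a ^ x := Real.one_lt_rpow ha hx
    have : (a ^ x)⁻¹ < 1 := inv_lt_one_of_one_lt₀ h2
    linarith

omit [NumberField F] in
/-- **A conjugate self-dual cuspidal datum is unitary almost everywhere**: if `t_{π, c w} = t_{π,w}⁻¹`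
for almost all `w` then `|det t_{π,w}| = 1` for almost all `w`.  By the unitary normalisation of a
cuspidal Borel–Jacquet datum (`CuspidalAutomorphicRepData.exists_satake_eq_cpow_mul_L2_unconditional`,
Borel–Jacquet 1979, 5.7) `t_{π,w} = q_w^{s} u_w` off a finite set with `|det u_w| = 1`
(`HasSatakeParameterAt.norm_prod_eq_one`), so `|det t_{π,w}| = q_w^{N re s}` and
`|det t_{π,cw}| = q_{cw}^{N re s} = |det t_{π,w}|⁻¹ = q_w^{-N re s}` force `re s = 0`.
[cite: BorelJacquetCorvallis1979, 5.7] -/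
theorem eventually_norm_prod_eq_one_of_isConjSelfDualAE {c : E ≃ₐ[F] E} {N : ℕ}
    {hcpt : isCompact_glFiniteIntegralLevel N E} (hN : 0 < N) (π : CuspidalAutomorphicRepData N E hcpt)
    (hπ : π.1.IsConjSelfDualAE c) :
    ∀ᶠ w : HeightOneSpectrum (𝓞 E) in cofinite, ∀ α : Multiset ℂ, π.1.HasSatakeParamAt w α → ‖α.prod‖ = 1 := by
  haveI : NeZero N := ⟨hN.ne'⟩
  obtain ⟨μ, hμ⟩ := AdelicGroupData.exists_isAutomorphicMeasure_gl_holds (n := N) (K := E)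
  haveI := hμ
  obtain ⟨s, P, S, αP, hSfin, hαP, hsat⟩ :=
    CuspidalAutomorphicRepData.exists_satake_eq_cpow_mul_L2_unconditional hcpt μ π
  have hu : ∀ w ∉ S, ‖(αP w).prod‖ = 1 := fun w hw => by
    obtain ⟨𝔫, -, -, ϖ, hSat⟩ := hαP w hw
    exact hSat.norm_prod_eq_one
  have hcS : ((c • ·) ⁻¹' S : Set (HeightOneSpectrum (𝓞 E))).Finite :=
    hSfin.preimage (MulAction.injective c).injOn
  -- the norm of `det t_{π,w}` off `S`
  have hnorm : ∀ w ∉ S, ∀ α : Multiset ℂ, π.1.HasSatakeParamAt w α →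
      ‖α.prod‖ = (w.residueCard : ℝ) ^ ((N : ℝ) * s.re) := by
    intro w hw α hα
    have hcard : Multiset.card (αP w) = N := by
      have := hα.card_eq
      rw [(hsat w hw α).mp hα, Multiset.card_map] at this
      exact this
    rw [(hsat w hw α).mp hα, prod_map_const_mul_eq, norm_mul, hu w hw, mul_one, norm_pow, hcard,
      Complex.norm_natCast_cpow_of_pos (zero_lt_one.trans w.one_lt_residueCard), ← Real.rpow_natCast,
      ← Real.rpow_mul (Nat.cast_nonneg _), mul_comm]
  filter_upwards [hSfin.compl_mem_cofinite, hcS.compl_mem_cofinite, hπ] with w hw hcw hcsd α hα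
  have hcw' : c • w ∉ S := hcw
  set β : Multiset ℂ := (αP (c • w)).map ((((c • w).residueCard : ℂ)) ^ s * ·) with hβ
  have hβsat : π.1.HasSatakeParamAt (c • w) β := (hsat (c • w) hcw' β).mpr rfl
  have h1 := hnorm w hw α hα
  have h2 := hnorm (c • w) hcw' β hβsat
  rw [hcsd α β hα hβsat, Multiset.prod_map_inv, Multiset.map_id', norm_inv, h1] at h2
  have ha : (1 : ℝ) < (w.residueCard : ℝ) := by exact_mod_cast w.one_lt_residueCard
  have hb : (1 : ℝ) < ((c • w).residueCard : ℝ) := by exact_mod_cast (c • w).one_lt_residueCard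
  have hx := eq_zero_of_rpow_eq_inv_rpow ha hb h2.symm
  rw [h1, hx, Real.rpow_zero]

end Unitary

/-! ### Matched Asai data for `Q = AI_{L/K}(P)` -/

section Matched

variable {F₀ K F' F L : Type} [Field F₀] [NumberField F₀] [Field K] [NumberField K]
  [Field F'] [NumberField F'] [Field F] [NumberField F] [Field L] [NumberField L]
  [Algebra F₀ K] [Algebra K L] [Algebra F₀ L] [IsScalarTower F₀ K L]
  [Algebra F₀ F'] [Algebra F' L] [IsScalarTower F₀ F' L]
  [Algebra F₀ F] [Algebra F L] [IsScalarTower F₀ F L]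

/-- The preimage of a finite set of places of `F₀` in an extension is finite (finite fibres). [folklore] -/
theorem finite_preimage_under {E' : Type} [Field E'] [NumberField E'] [Algebra F₀ E']
    {S : Set (HeightOneSpectrum (𝓞 F₀))} (hS : S.Finite) :
    ((fun v' : HeightOneSpectrum (𝓞 E') => v'.under (𝓞 F₀)) ⁻¹' S).Finite := by
  refine hS.preimage' fun v _ => ?_
  have h := finite_placesOver (E := E') v
  rw [← Set.finite_coe_iff]
  convert h using 2 with v'
  simp [Set.mem_preimage]

/-- **Matched Asai data.**  For cuspidal `P` on `GL_n(𝔸_L)` and `Q` on `GL_N(𝔸_K)` with `Q` a weak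
automorphic induction of `P` (`IsAutomorphicInductionAlong`), there are a finite set `S₁` of places of
`F₀` and Satake families `A` of `Q`, `A'` of `P` such that: `(S₁, A)` is an Asai datum of `Q` w.r.t.
`(K/F₀, cK)`; `(S₁', A')`, `(S₁'', A')` are Asai data of `P` w.r.t. `(L/F', sF)`, `(L/F, θF)` (`S₁'`,
`S₁''` the preimages of `S₁`); every `v ∉ S₁` is unramified in `L`, as are the places of `K`, `F'`, `F`
above it; and `A` is induced from `A'` above every `v ∉ S₁` (`P_{A u} = ∏_{w|u} P_{A' w}(X^{f(w|u)})`).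
Ingredients: Flath (`hasSatakeParamAt_cofinite_holds`), uniqueness of Satake parameters
(`hasSatakeParamAt_unique_holds`), finiteness of ramification (`finite_setOf_not_isUnramifiedIn`), and
"a fixed place above an unramified one is inert" (`inertiaDeg_eq_two_of_smul_eq_of_isUnramifiedIn`).
[folklore] -/
theorem exists_matched_data (h2 : Module.finrank F₀ K = 2) (h2F' : Module.finrank F' L = 2)
    (h2F : Module.finrank F L = 2) {cK : K ≃ₐ[F₀] K} (hcK : cK ≠ 1) {sF : L ≃ₐ[F'] L} (hsF : sF ≠ 1)
    {θF : L ≃ₐ[F] L} (hθF : θF ≠ 1)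
    {n N : ℕ} {hL : isCompact_glFiniteIntegralLevel n L} {hK : isCompact_glFiniteIntegralLevel N K}
    (P : AutomorphicRepData (AutomorphyDatum.gl n L hL)) (Q : AutomorphicRepData (AutomorphyDatum.gl N K hK))
    (hAI : IsAutomorphicInductionAlong P Q) :
    ∃ (S₁ : Set (HeightOneSpectrum (𝓞 F₀))) (A : SatakeFamily K) (A' : SatakeFamily L),
      Q.IsAsaiDatum cK S₁ A ∧
      P.IsAsaiDatum sF ((fun v' : HeightOneSpectrum (𝓞 F') => v'.under (𝓞 F₀)) ⁻¹' S₁) A' ∧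
      P.IsAsaiDatum θF ((fun v'' : HeightOneSpectrum (𝓞 F) => v''.under (𝓞 F₀)) ⁻¹' S₁) A' ∧
      (∀ v ∉ S₁, Algebra.IsUnramifiedIn (𝓞 L) v.asIdeal) ∧
      (∀ u : HeightOneSpectrum (𝓞 K), u.under (𝓞 F₀) ∉ S₁ → Algebra.IsUnramifiedIn (𝓞 L) u.asIdeal) ∧
      (∀ v' : HeightOneSpectrum (𝓞 F'), v'.under (𝓞 F₀) ∉ S₁ → Algebra.IsUnramifiedIn (𝓞 L) v'.asIdeal) ∧
      (∀ v'' : HeightOneSpectrum (𝓞 F), v''.under (𝓞 F₀) ∉ S₁ → Algebra.IsUnramifiedIn (𝓞 L) v''.asIdeal) ∧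
      (∀ u : HeightOneSpectrum (𝓞 K), u.under (𝓞 F₀) ∉ S₁ →
        satakePolynomial (A u) = inducedSatakePolynomial u A') := by
  -- the Satake families
  set A' : SatakeFamily L := fun w => if h : P.IsUnramifiedAt w then h.choose else 0 with hA'
  set A : SatakeFamily K := fun u => if h : Q.IsUnramifiedAt u then h.choose else 0 with hA
  have hA'w : ∀ w, P.IsUnramifiedAt w → P.HasSatakeParamAt w (A' w) := fun w h => by
    simp only [hA', dif_pos h]; exact h.choose_spec
  have hAu : ∀ u, Q.IsUnramifiedAt u → Q.HasSatakeParamAt u (A u) := fun u h => by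
    simp only [hA, dif_pos h]; exact h.choose_spec
  -- the relation of automorphic induction at a place `u`
  let AI : HeightOneSpectrum (𝓞 K) → Prop := fun u => ∀ β : HeightOneSpectrum (𝓞 L) → Multiset ℂ,
    (∀ w : HeightOneSpectrum (𝓞 L), w.asIdeal.under (𝓞 K) = u.asIdeal → P.HasSatakeParamAt w (β w)) →
      ∃ α : Multiset ℂ, Q.HasSatakeParamAt u α ∧ satakePolynomial α = inducedSatakePolynomial u β
  -- the bad sets, all finite
  set BL : Set (HeightOneSpectrum (𝓞 L)) := {w | ¬ P.IsUnramifiedAt w} with hBL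
  set BK : Set (HeightOneSpectrum (𝓞 K)) :=
    {u | ¬ Algebra.IsUnramifiedIn (𝓞 L) u.asIdeal ∨ ¬ Q.IsUnramifiedAt u ∨ ¬ AI u} with hBK
  set BF' : Set (HeightOneSpectrum (𝓞 F')) := {v' | ¬ Algebra.IsUnramifiedIn (𝓞 L) v'.asIdeal} with hBF'
  set BF : Set (HeightOneSpectrum (𝓞 F)) := {v'' | ¬ Algebra.IsUnramifiedIn (𝓞 L) v''.asIdeal} with hBF
  set B₀ : Set (HeightOneSpectrum (𝓞 F₀)) :=
    {v | ¬ Algebra.IsUnramifiedIn (𝓞 L) v.asIdeal ∨ ¬ Algebra.IsUnramifiedIn (𝓞 K) v.asIdeal} with hB₀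
  have hBLfin : BL.Finite := by
    have h := AutomorphicRepData.hasSatakeParamAt_cofinite_holds P
    rwa [AutomorphicRepData.hasSatakeParamAt_cofinite, Filter.eventually_cofinite] at h
  have hBKfin : BK.Finite := by
    refine ((Literature.NumberTheory.GaloisRepresentations.finite_setOf_not_isUnramifiedIn K L).union
      (?_ : {u : HeightOneSpectrum (𝓞 K) | ¬ Q.IsUnramifiedAt u}.Finite)).union
      (?_ : {u : HeightOneSpectrum (𝓞 K) | ¬ AI u}.Finite) |>.subset ?_
    · have h := AutomorphicRepData.hasSatakeParamAt_cofinite_holds Q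
      rwa [AutomorphicRepData.hasSatakeParamAt_cofinite, Filter.eventually_cofinite] at h
    · have h : ∀ᶠ u in cofinite, AI u := hAI
      rwa [Filter.eventually_cofinite] at h
    · intro u hu
      simp only [hBK, Set.mem_setOf_eq] at hu
      simp only [Set.mem_union, Set.mem_setOf_eq]
      tauto
  have hBF'fin : BF'.Finite := Literature.NumberTheory.GaloisRepresentations.finite_setOf_not_isUnramifiedIn F' L
  have hBFfin : BF.Finite := Literature.NumberTheory.GaloisRepresentations.finite_setOf_not_isUnramifiedIn F L
  have hB₀fin : B₀.Finite :=
    ((Literature.NumberTheory.GaloisRepresentations.finite_setOf_not_isUnramifiedIn F₀ L).union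
      (Literature.NumberTheory.GaloisRepresentations.finite_setOf_not_isUnramifiedIn F₀ K)).subset
      fun v hv => by
        simp only [hB₀, Set.mem_setOf_eq] at hv
        simp only [Set.mem_union, Set.mem_setOf_eq]
        exact hv
  -- the exceptional set
  set S₁ : Set (HeightOneSpectrum (𝓞 F₀)) := B₀ ∪ (fun w : HeightOneSpectrum (𝓞 L) => w.under (𝓞 F₀)) '' BL ∪
    (fun u : HeightOneSpectrum (𝓞 K) => u.under (𝓞 F₀)) '' BK ∪
    (fun v' : HeightOneSpectrum (𝓞 F') => v'.under (𝓞 F₀)) '' BF' ∪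
    (fun v'' : HeightOneSpectrum (𝓞 F) => v''.under (𝓞 F₀)) '' BF with hS₁
  have hS₁fin : S₁.Finite :=
    (((hB₀fin.union (hBLfin.image _)).union (hBKfin.image _)).union (hBF'fin.image _)).union (hBFfin.image _)
  -- reading off the good properties outside `S₁`
  have gL : ∀ v ∉ S₁, Algebra.IsUnramifiedIn (𝓞 L) v.asIdeal := fun v hv => by
    by_contra h; exact hv (Or.inl (Or.inl (Or.inl (Or.inl (Or.inl h)))))
  have gK₀ : ∀ v ∉ S₁, Algebra.IsUnramifiedIn (𝓞 K) v.asIdeal := fun v hv => by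
    by_contra h; exact hv (Or.inl (Or.inl (Or.inl (Or.inl (Or.inr h)))))
  have gP : ∀ w : HeightOneSpectrum (𝓞 L), w.under (𝓞 F₀) ∉ S₁ → P.IsUnramifiedAt w := fun w hw => by
    by_contra h; exact hw (Or.inl (Or.inl (Or.inl (Or.inr ⟨w, h, rfl⟩))))
  have gK : ∀ u : HeightOneSpectrum (𝓞 K), u.under (𝓞 F₀) ∉ S₁ →
      Algebra.IsUnramifiedIn (𝓞 L) u.asIdeal ∧ Q.IsUnramifiedAt u ∧ AI u := fun u hu => by
    by_contra h
    refine hu (Or.inl (Or.inl (Or.inr ⟨u, ?_, rfl⟩)))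
    simp only [hBK, Set.mem_setOf_eq]
    tauto
  have gF' : ∀ v' : HeightOneSpectrum (𝓞 F'), v'.under (𝓞 F₀) ∉ S₁ →
      Algebra.IsUnramifiedIn (𝓞 L) v'.asIdeal := fun v' hv' => by
    by_contra h; exact hv' (Or.inl (Or.inr ⟨v', h, rfl⟩))
  have gF : ∀ v'' : HeightOneSpectrum (𝓞 F), v''.under (𝓞 F₀) ∉ S₁ →
      Algebra.IsUnramifiedIn (𝓞 L) v''.asIdeal := fun v'' hv'' => by
    by_contra h; exact hv'' (Or.inr ⟨v'', h, rfl⟩)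
  -- the induced relation
  have hrel : ∀ u : HeightOneSpectrum (𝓞 K), u.under (𝓞 F₀) ∉ S₁ →
      satakePolynomial (A u) = inducedSatakePolynomial u A' := by
    intro u hu
    obtain ⟨-, hQu, hAIu⟩ := gK u hu
    obtain ⟨α, hα, hαA'⟩ := hAIu A' fun w hw => hA'w w (gP w (by
      rw [← under_under_place (F := K) w, show w.under (𝓞 K) = u from HeightOneSpectrum.ext hw]; exact hu))
    rw [← hαA', AutomorphicRepData.hasSatakeParamAt_unique_holds Q (hAu u hQu) hα]
  refine ⟨S₁, A, A', ⟨hS₁fin, fun u hu => hAu u (gK u hu).2.1, fun u hu hcu => ?_⟩,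
    ⟨finite_preimage_under hS₁fin, fun w hw => hA'w w (gP w ?_), fun w hw hsw => ?_⟩,
    ⟨finite_preimage_under hS₁fin, fun w hw => hA'w w (gP w ?_), fun w hw hθw => ?_⟩,
    gL, fun u hu => (gK u hu).1, gF', gF, hrel⟩
  · exact inertiaDeg_eq_two_of_smul_eq_of_isUnramifiedIn h2 hcK hcu (gK₀ _ hu)
  · rwa [Set.mem_preimage, under_under_place] at hw
  · rw [Set.mem_preimage, under_under_place] at hw
    exact inertiaDeg_eq_two_of_smul_eq_of_isUnramifiedIn h2F' hsF hsw (gF' _ (by rwa [under_under_place]))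
  · rwa [Set.mem_preimage, under_under_place] at hw
  · rw [Set.mem_preimage, under_under_place] at hw
    exact inertiaDeg_eq_two_of_smul_eq_of_isUnramifiedIn h2F hθF hθw (gF _ (by rwa [under_under_place]))

end Matched

/-- **Registered anchor** of this helper file (stub registry of stmt-Langlands-10902, line
`one-transparent-pane`, chain `stub_asaiPoleInduced` 6/7): `b^x = (a^x)⁻¹` with `a, b > 1` forces `x = 0`,
`eq_zero_of_rpow_eq_inv_rpow`. [folklore] -/
theorem asaiGlobalFactorisation_anchor : ∀ (a b x : ℝ), 1 < a → 1 < b → b ^ x = (a ^ x)⁻¹ → x = 0 :=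
  fun _ _ _ ha hb h => eq_zero_of_rpow_eq_inv_rpow ha hb h

end Summit.Langlands.Langlands.Theorems.HostInducedRep.OneTransparentPane
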